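import Literature.AlgebraicGeometry.Resolution.GenericPointStalkData
import Literature.AlgebraicGeometry.Resolution.RegularCentreComponents
import Literature.AlgebraicGeometry.Resolution.MarkedIdealsArithmetic
import HarnessLib

/-!
# [OURS · L1 W4.5(b) · EL♮(3) · T23-A′ text-owner bridge] The stalkwise crossing conditions (T1)/(T2) of the transversal transport
# bricks from the DOWNSTAIRS set-theoretic rule (`…NatTraceCrossingStalkwise`)

Crux chain w45b (cell `res-hironaka`, slot W4.5(b)), child **EL♮(3)** = stmt-ResolutionOfSingularities-20148, line `sections`; engine widening
T23-A′ «B-TRACE» (res-L1-w45b-stub-4 g10, SIG v2 `L/res-L1-w45b-stub-4/T23Aprime-TransversalTransport.sig.v2.lean` 767f3543c2b2e4ae). The bricks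
(A′-1) v2 (p608670 `hasSNCWith_member_centre_of_trace_transversal`) and (A′-3) v2 carry the crossing of the round's downstairs centre `Z` with the
trace `F` of a retained member STALKWISE: (T1) `𝓘⟨Z⟩_g ⊔ 𝓘⟨F⟩_g = 𝔪_{G,g}` and (T2) `𝓘⟨Z⟩_g ≠ 𝔪_{G,g}` at every `g ∈ Z ∩ F`. The SIG header (v2)
assigns to the TEXT OWNER the bridge from the rule a registered text / a residue reader states downstairs — «`Z ∩ F` finite with closed
points, `𝓘⟨Z⟩ ⊔ 𝓘⟨F⟩ = 𝓘⟨Z ∩ F⟩`, `Z` an irreducible closed set which is not a point» — to (T1)/(T2). THIS FILE is that bridge (S-sized,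
pure point-set / stalk bookkeeping over the tree's `stalkIdeal` API). Written by res-L1-w45b-lead-2 g5 (text owner). HONEST FRAMING: OURS;
replaces the role of NOTHING printed in H. Hironaka's 2017 manuscript and is NOT a statement of it; AI-written, gate-checked, weaker than
expert review. No `sorry`; standard axioms; DEF-FREE. `--supports stmt-ResolutionOfSingularities-20148 --as helper`.

CONTENT.
* `stalkIdeal_vanishingIdeal_eq_maximalIdeal_of_finite` — for a FINITE closed set `S` all of whose points are closed and `g ∈ S`:
  `𝓘⟨S⟩_g = 𝔪_g` (`S = {g} ∪ (S ∖ {g})`, both closed; `𝓘⟨{g}⟩_g = 𝔪_g` at the generic point `g` of `{g}` (tree `GenericPointStalkData`),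
  `𝓘⟨S ∖ {g}⟩_g = ⊤` off the set (tree `stalkIdeal_vanishingIdeal_of_not_mem`), and stalks commute with `⊓` (tree `stalkIdeal_inf`)).
* `stalkIdeal_sup_eq_maximalIdeal_of_trace_rule` — (T1) from the rule `(Z ∩ F).Finite`, closed crossing points, `𝓘⟨Z⟩ ⊔ 𝓘⟨F⟩ = 𝓘⟨Z ∩ F⟩`.
* `stalkIdeal_vanishingIdeal_ne_maximalIdeal_of_isIrreducible` — (T2) for `Z` closed irreducible, `g ∈ Z` a closed point with `Z ≠ {g}`:
  if `𝓘⟨Z⟩_g = 𝔪_g` then, `𝓘⟨Z⟩_g` being the prime `𝔭_η ⊆ 𝒪_{G,g}` of the generic point `η` of `Z` (tree `stalkIdeal_vanishingIdeal_closure`),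
  `𝔭_g ≤ 𝔭_η` gives `g ⤳ η` (tree `specializes_of_primeOfSpecializes_le`, Stacks 01J7), so `η = g` and `Z = {g}`.
* `trace_rule_to_stalkwise` — both at once, in the binder shape of (A′-1)/(A′-3) v2.

References (method / index only): The Stacks Project, Tag 01J7 (points of `Spec 𝒪_{X,x}` = generizations of `x`); R. Hartshorne, *Algebraic
Geometry* (1977), II Ex. 2.9 (generic points), II §3.
-/

set_option linter.dupNamespace false -- mandated namespace `Summit.<Summit>.<Problem>` of this single-conjunct summit

noncomputable section

open CategoryTheory AlgebraicGeometry TopologicalSpace Topology IsLocalRing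
open Literature.AlgebraicGeometry.Resolution
open AlgebraicGeometry.Scheme.IdealSheafData

namespace Summit.ResolutionOfSingularities.ResolutionOfSingularities.Cruxes.EquisingularLiftNat.Sections

variable {G : Scheme.{0}}

/-- **The reduced ideal of a finite set of closed points has stalk `𝔪_g` at each of its points.** For `S ⊆ G` finite and closed, all of
whose points are closed, and `g ∈ S`: `𝓘⟨S⟩_g = 𝔪_{G,g}`. [cite: StacksProject, Tag 01J7] [OURS · L1 W4.5b · T23-A′ bridge] -/
theorem stalkIdeal_vanishingIdeal_eq_maximalIdeal_of_finite {S : Set G} (hS : IsClosed S) (hfin : S.Finite)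
    (hcl : ∀ s ∈ S, IsClosed ({s} : Set G)) {g : G} (hg : g ∈ S) :
    stalkIdeal (vanishingIdeal (⟨S, hS⟩ : Closeds G)) g = maximalIdeal (G.presheaf.stalk g) := by
  -- `S = {g} ∪ (S ∖ {g})`, both closed
  have hg1 : IsClosed ({g} : Set G) := hcl g hg
  have hS2 : IsClosed (S \ {g}) := by
    have : S \ {g} = ⋃ s ∈ S \ {g}, {s} := (Set.biUnion_of_singleton _).symm
    rw [this]
    exact (hfin.sdiff).isClosed_biUnion fun s hs => hcl s hs.1
  have hdec : (⟨S, hS⟩ : Closeds G) = (⟨{g}, hg1⟩ : Closeds G) ⊔ ⟨S \ {g}, hS2⟩ := by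
    apply Closeds.ext
    simp only [Closeds.coe_sup, Closeds.coe_mk]
    rw [Set.union_comm, Set.sdiff_union_self, Set.union_eq_self_of_subset_right (Set.singleton_subset_iff.mpr hg)]
  rw [hdec, vanishingIdeal_sup, stalkIdeal_inf]
  -- `𝓘⟨{g}⟩_g = 𝔪_g` and `𝓘⟨S ∖ {g}⟩_g = ⊤`
  have h1 : stalkIdeal (vanishingIdeal (⟨{g}, hg1⟩ : Closeds G)) g = maximalIdeal (G.presheaf.stalk g) :=
    stalkIdeal_vanishingIdeal_eq_maximalIdeal_of_closure_eq (by rw [Closeds.coe_mk, hg1.closure_eq])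
  have h2 : stalkIdeal (vanishingIdeal (⟨S \ {g}, hS2⟩ : Closeds G)) g = ⊤ :=
    stalkIdeal_vanishingIdeal_of_not_mem (by simp)
  rw [h1, h2, inf_top_eq]

/-- **(T1) from the downstairs rule.** If `Z ∩ F` is finite with closed points and the reduced ideals satisfy `𝓘⟨Z⟩ ⊔ 𝓘⟨F⟩ = 𝓘⟨Z ∩ F⟩`
(reduced crossing), then `𝓘⟨Z⟩_g ⊔ 𝓘⟨F⟩_g = 𝔪_{G,g}` at every `g ∈ Z ∩ F`. [cite: StacksProject, Tag 01J7] [OURS · L1 W4.5b · T23-A′ bridge] -/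
theorem stalkIdeal_sup_eq_maximalIdeal_of_trace_rule {Z F : Set G} (hZ : IsClosed Z) (hF : IsClosed F)
    (hfin : (Z ∩ F).Finite) (hcl : ∀ g ∈ Z ∩ F, IsClosed ({g} : Set G))
    (htr : vanishingIdeal (⟨Z, hZ⟩ : Closeds G) ⊔ vanishingIdeal ⟨F, hF⟩ = vanishingIdeal ⟨Z ∩ F, hZ.inter hF⟩) :
    ∀ g ∈ Z ∩ F, stalkIdeal (vanishingIdeal (⟨Z, hZ⟩ : Closeds G)) g ⊔ stalkIdeal (vanishingIdeal (⟨F, hF⟩ : Closeds G)) g =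
      maximalIdeal (G.presheaf.stalk g) := by
  intro g hg
  rw [← stalkIdeal_sup, htr]
  exact stalkIdeal_vanishingIdeal_eq_maximalIdeal_of_finite (hZ.inter hF) hfin hcl hg

/-- **(T2): on an irreducible closed set which is not a point, the reduced ideal is never the maximal ideal at a closed point.** For `Z ⊆ G`
closed and irreducible, `g ∈ Z` with `{g}` closed and `Z ≠ {g}`: `𝓘⟨Z⟩_g ≠ 𝔪_{G,g}` — `𝓘⟨Z⟩_g` is the prime of the generic point `η` of `Z` in
`𝒪_{G,g}`, and `𝔭_η = 𝔪_g = 𝔭_g` would force `g ⤳ η`, i.e. `η = g`. [cite: StacksProject, Tag 01J7] [OURS · L1 W4.5b · T23-A′ bridge] -/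
theorem stalkIdeal_vanishingIdeal_ne_maximalIdeal_of_isIrreducible {Z : Set G} (hZ : IsClosed Z) (hirr : IsIrreducible Z) {g : G}
    (hg : g ∈ Z) (hgcl : IsClosed ({g} : Set G)) (hZg : Z ≠ {g}) :
    stalkIdeal (vanishingIdeal (⟨Z, hZ⟩ : Closeds G)) g ≠ maximalIdeal (G.presheaf.stalk g) := by
  intro heq
  -- the generic point `η` of `Z`
  set η := hirr.genericPoint with hη
  have hgen : IsGenericPoint η Z := hirr.isGenericPoint_genericPoint hZ
  have hZeq : Z = closure {η} := hgen.symm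
  have hηg : η ⤳ g := hgen.specializes hg
  -- `𝓘⟨Z⟩_g = 𝔭_η`
  have h1 : stalkIdeal (vanishingIdeal (⟨Z, hZ⟩ : Closeds G)) g = primeOfSpecializes hηg := by
    have : (⟨Z, hZ⟩ : Closeds G) = ⟨closure {η}, isClosed_closure⟩ := Closeds.ext hZeq
    rw [this]
    exact stalkIdeal_vanishingIdeal_closure hηg
  -- `𝔭_g = 𝔪_g ≤ 𝔭_η` ⟹ `g ⤳ η`
  have hle : primeOfSpecializes (specializes_refl g) ≤ primeOfSpecializes hηg := by
    rw [primeOfSpecializes_refl, ← heq, h1]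
  have hgη : g ⤳ η := specializes_of_primeOfSpecializes_le hηg (specializes_refl g) hle
  have hηeq : η = g := by
    have : η ∈ closure ({g} : Set G) := hgη.mem_closure
    rwa [hgcl.closure_eq, Set.mem_singleton_iff] at this
  apply hZg
  rw [hZeq, hηeq, hgcl.closure_eq]

/-- **The downstairs rule ⟹ (T1) ∧ (T2)**, in the binder shape of the T23-A′ bricks (A′-1)/(A′-3) v2: `Z` closed irreducible and not a point,
`F` closed, `Z ∩ F` finite with closed points, reduced crossing `𝓘⟨Z⟩ ⊔ 𝓘⟨F⟩ = 𝓘⟨Z ∩ F⟩`. [cite: StacksProject, Tag 01J7]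
[OURS · L1 W4.5b · T23-A′ bridge] -/
theorem trace_rule_to_stalkwise {Z F : Set G} (hZ : IsClosed Z) (hF : IsClosed F) (hirr : IsIrreducible Z)
    (hZpt : ∀ g ∈ Z, Z ≠ {g}) (hfin : (Z ∩ F).Finite) (hcl : ∀ g ∈ Z ∩ F, IsClosed ({g} : Set G))
    (htr : vanishingIdeal (⟨Z, hZ⟩ : Closeds G) ⊔ vanishingIdeal ⟨F, hF⟩ = vanishingIdeal ⟨Z ∩ F, hZ.inter hF⟩) :
    (∀ g ∈ Z ∩ F, stalkIdeal (vanishingIdeal (⟨Z, hZ⟩ : Closeds G)) g ⊔ stalkIdeal (vanishingIdeal (⟨F, hF⟩ : Closeds G)) g =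
        maximalIdeal (G.presheaf.stalk g)) ∧
      ∀ g ∈ Z ∩ F, stalkIdeal (vanishingIdeal (⟨Z, hZ⟩ : Closeds G)) g ≠ maximalIdeal (G.presheaf.stalk g) :=
  ⟨stalkIdeal_sup_eq_maximalIdeal_of_trace_rule hZ hF hfin hcl htr,
    fun g hg => stalkIdeal_vanishingIdeal_ne_maximalIdeal_of_isIrreducible hZ hirr hg.1 (hcl g hg) (hZpt g hg.1)⟩

end Summit.ResolutionOfSingularities.ResolutionOfSingularities.Cruxes.EquisingularLiftNat.Sections

end
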